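import Summits.ResolutionOfSingularities.ResolutionOfSingularities.Theses.FrobeniusLadder
import Literature.RingTheory.TightClosure.TightClosure
import Literature.RingTheory.TightClosure.RegularTightlyClosed
import Literature.AlgebraicGeometry.Resolution.ResolutionOfCurves
import Summits.ResolutionOfSingularities.ResolutionOfSingularities.Theorems.FrobeniusLadderFRationalModificationReduction
import Summits.ResolutionOfSingularities.ResolutionOfSingularities.Theorems.FRationalModification.Negative.LoadBearing
import Mathlib.AlgebraicGeometry.Noetherian
import HarnessLib

/-!
# Crux `FRationalModification` — the integral form, the summit shadow of the open stub, dimension `≤ 1`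

Support lemmas for crux stmt-ResolutionOfSingularities-15316
(`Summit.ResolutionOfSingularities.ResolutionOfSingularities.Theses.FrobeniusLadder.FRationalModification`,
route `FrobeniusLadder`, rung 3), filed by the line lead (line `Sketch`, skeleton
`Cruxes/FRationalModification/Lines/Sketch.lean` v6):

* §1 `fRationalModification_iff_integral` — the crux is EQUIVALENT to its plain integral form: "for
  every prime `p`, field `k` of characteristic `p` and INTEGRAL separated finite-type `Y/k` whose stalks
  are rung-2 (domain; every system of parameters a weakly regular sequence generating a Frobenius-closed
  ideal), there is a proper birational `Y₂ → Y` whose stalks are rung-3 (domain; every ideal generated by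
  a system of parameters tightly closed)". This is the sentence "equivalent to 'every integral CM
  F-injective variety has a proper birational F-rational model' modulo folklore" of the item text,
  proved (backward: `Reduction.stub_reduction`; forward: an integral rung-2 `Y` is its own rung-2 model).
* §2 `integralModel_of_hasResolution` — a resolution of `Y` witnesses the line's open stub
  `stub_integralModel` at `Y` (chart `S = 𝒪_{Y₂,x}` itself, F-rational because regular, tree
  `isFRational_of_isRegularLocalRing`): the stub is implied by the summit, so it is consistent and not
  refutable short of `¬ResolutionOfSingularities`.
* §3 `integralModel_of_dim_le_one`, `rungThreeModel_of_dim_le_one` — dimension `≤ 1`, unconditionally: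
  a reduced `Y/k` of finite type with `dim Y ≤ 1` is resolved by its normalisation (tree
  `hasResolution_of_dim_le_one`, no named fact), which is an F-rational model and a witness of the stub.
  So the open content of the crux starts in dimension `2` (and, modulo the named fact
  `CossartPiltant2019`, in dimension `4`).

No definition is declared; every statement is written inline in the route file's vocabulary.
-/

-- single-problem summit: the doubled namespace component `ResolutionOfSingularities` is forced
set_option linter.dupNamespace false

noncomputable section

open CategoryTheory AlgebraicGeometry TopologicalSpace IsLocalRing RingTheory.Sequence
open Literature.RingTheory.TightClosure Literature.AlgebraicGeometry.Resolution
open Summit.ResolutionOfSingularities.ResolutionOfSingularities.Theses.FrobeniusLadder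

namespace Summit.ResolutionOfSingularities.ResolutionOfSingularities.Theorems.FRationalModification.IntegralForm

/-! ## §1 The crux is equivalent to its plain integral form -/

/-- **Crux `FRationalModification` ↔ its integral form.** The rung-3 crux of route `FrobeniusLadder`
(a separated finite-type reduced `X/k`, `char k = p` prime, with a rung-2 proper birational model has a
rung-3 proper birational model) is EQUIVALENT to: for every prime `p`, field `k` of characteristic `p`
and INTEGRAL separated `k`-scheme `Y` of finite type whose stalks are rung-2 (domain; every system of
parameters weakly regular; parameter ideals Frobenius closed — inline), there is a proper birational
`π : Y₂ → Y` whose stalks are rung-3 (domain; parameter ideals tightly closed — inline). Forward: an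
integral `Y` is reduced and is its own rung-2 model along `𝟙 Y` (birational over `⊤`). Backward:
`Reduction.stub_reduction` (clopen integral components of the rung-2 model, disjoint union of the
components' models, composition with the model map). [folklore] -/
theorem fRationalModification_iff_integral :
    FRationalModification ↔
      ∀ p : ℕ, p.Prime → ∀ (k : Type) [Field k] [CharP k p] (Y : Scheme.{0})
        (g : Y ⟶ Spec (.of k)), IsSeparated g → LocallyOfFiniteType g → QuasiCompact g →
        IsIntegral Y →
        (∀ y : Y, IsDomain (Y.presheaf.stalk y) ∧ ∀ d : ℕ, ringKrullDim (Y.presheaf.stalk y) = d →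
          ∀ s : Fin d → Y.presheaf.stalk y, (Ideal.span (Set.range s)).radical.IsMaximal →
            RingTheory.Sequence.IsWeaklyRegular (Y.presheaf.stalk y) (List.ofFn s) ∧
            ∀ w : Y.presheaf.stalk y, (∃ e : ℕ, w ^ p ^ e ∈
              Ideal.span ((fun z : Y.presheaf.stalk y => z ^ p ^ e) ''
                (Ideal.span (Set.range s) : Set (Y.presheaf.stalk y)))) →
              w ∈ Ideal.span (Set.range s)) →
        ∃ (Y₂ : Scheme.{0}) (π : Y₂ ⟶ Y), IsProper π ∧ IsBirational π ∧ ∀ x : Y₂,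
          IsDomain (Y₂.presheaf.stalk x) ∧ ∀ d : ℕ, ringKrullDim (Y₂.presheaf.stalk x) = d →
            ∀ s : Fin d → Y₂.presheaf.stalk x, (Ideal.span (Set.range s)).radical.IsMaximal →
              ∀ y c : Y₂.presheaf.stalk x, c ≠ 0 →
                (∀ e : ℕ, c * y ^ p ^ e ∈
                  Ideal.span ((fun z : Y₂.presheaf.stalk x => z ^ p ^ e) ''
                    (Ideal.span (Set.range s) : Set (Y₂.presheaf.stalk x)))) →
                y ∈ Ideal.span (Set.range s) := by
  unfold FRationalModification
  constructor
  · intro h p hp k _ _ Y g hsep hft hqc hint h₂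
    haveI := hint
    exact h p hp k Y g hsep hft hqc inferInstance
      ⟨Y, 𝟙 Y, inferInstance, ⟨⊤, by simp, by simp, inferInstance⟩, h₂⟩
  · intro hint p hp k _ _ X f hsep hft hqc _ hX₁
    haveI := hsep; haveI := hft; haveI := hqc
    exact Reduction.stub_reduction p k X f
      (fun Y g hs hl hq hY h₂ => hint p hp k Y g hs hl hq hY h₂) hX₁

/-! ## §2 The summit shadow of the open stub `stub_integralModel` -/

/-- **A resolution of `Y` witnesses `stub_integralModel` for `Y`**: if `Y` (locally of finite type
over a field `k` of characteristic `p`) has a resolution `Y₂ → Y`, then `Y₂` is a proper birational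
model every stalk `R = 𝒪_{Y₂,x}` of which admits the trivial chart `S = R` — faithfully flat over
itself, of the same dimension, `𝔪 ⊆ rad 𝔪` — which is a Noetherian local domain of characteristic `p`
and F-rational because regular (Hochster–Huneke 4.4 via Kunz, tree `isFRational_of_isRegularLocalRing`).
The conclusion is the conclusion of the registered stub verbatim; so the stub is implied by the summit.
[cite: HochsterHuneke1994, Thm. 4.4; folklore] -/
theorem integralModel_of_hasResolution (p : ℕ) [Fact p.Prime] (k : Type) [Field k] [CharP k p]
    (Y : Scheme.{0}) (g : Y ⟶ Spec (.of k)) [LocallyOfFiniteType g] (hres : Scheme.HasResolution Y) :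
    ∃ (Y₂ : Scheme.{0}) (π : Y₂ ⟶ Y), IsProper π ∧ IsBirational π ∧
      ∀ x : Y₂, ∃ (S : Type) (_ : CommRing S) (_ : IsLocalRing S) (_ : IsNoetherianRing S)
        (_ : IsDomain S) (_ : CharP S p) (_ : Algebra (Y₂.presheaf.stalk x) S),
        Module.FaithfullyFlat (Y₂.presheaf.stalk x) S ∧
        ringKrullDim S = ringKrullDim (Y₂.presheaf.stalk x) ∧
        maximalIdeal S ≤ ((maximalIdeal (Y₂.presheaf.stalk x)).map
          (algebraMap (Y₂.presheaf.stalk x) S)).radical ∧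
        (IsFRational S p ∨
          ((∃ rs : List S, RingTheory.Sequence.IsRegular S rs ∧ (∀ r ∈ rs, r ∈ maximalIdeal S) ∧
              (rs.length : WithBot ℕ∞) = ringKrullDim S) ∧
            ∃ (d : ℕ) (g : S), ringKrullDim S = ((d + 1 : ℕ) : WithBot ℕ∞) ∧
              g ∈ maximalIdeal S ∧ g ≠ 0 ∧
              (∀ s : Fin d → S, (Ideal.span (insert g (Set.range s))).radical = maximalIdeal S →
                ∀ (y : S) (e : ℕ), y ^ p ^ e ∈
                  Ideal.span {g} ⊔ frobeniusPower (p ^ e) (Ideal.span (Set.range s)) →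
                  y ∈ Ideal.span (insert g (Set.range s))) ∧
              (∃ n : ℕ, ∀ ⦃m : ℕ⦄ (s : Fin m → S), IsSystemOfParameters s →
                ∀ y ∈ tightClosure p (Ideal.span (Set.range s)),
                  g ^ n * y ∈ Ideal.span (Set.range s)))) := by
  obtain ⟨Y₂, π, hπ⟩ := hres
  haveI := hπ.isProper
  haveI : IsLocallyNoetherian Y₂ := LocallyOfFiniteType.isLocallyNoetherian (π ≫ g)
  refine ⟨Y₂, π, hπ.isProper, hπ.isBirational, fun x => ?_⟩
  haveI : CharP (Y₂.presheaf.stalk x) p := Negative.charP_stalk (π ≫ g) x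
  have hR : IsRegularLocalRing (Y₂.presheaf.stalk x) := hπ.isRegular x
  haveI := hR
  haveI : IsDomain (Y₂.presheaf.stalk x) := isDomain_of_isRegularLocalRing _
  exact ⟨Y₂.presheaf.stalk x, inferInstance, inferInstance, inferInstance, inferInstance,
    inferInstance, Algebra.id _, inferInstance, rfl,
    fun m hm => Ideal.le_radical (Ideal.mem_map_of_mem _ hm),
    Or.inl (isFRational_of_isRegularLocalRing p _)⟩

/-! ## §3 Dimension `≤ 1`, unconditionally -/

/-- **`stub_integralModel` holds unconditionally in dimension `≤ 1`**: a reduced `Y/k` of finite type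
with `dim Y ≤ 1` is resolved by its normalisation (tree `hasResolution_of_dim_le_one`, no named fact),
and a resolution witnesses the stub (`integralModel_of_hasResolution`). Neither separatedness nor the
rung-2 hypothesis is used; by Disproof §3 (`Negative.localRungClimb_false`) the rung-2 hypothesis could
not replace the normalisation even for curves. [cite: Hartshorne1977, Ch. V Rem. 3.8.1; folklore] -/
theorem integralModel_of_dim_le_one (p : ℕ) [Fact p.Prime] (k : Type) [Field k] [CharP k p]
    (Y : Scheme.{0}) (g : Y ⟶ Spec (.of k)) [LocallyOfFiniteType g] [QuasiCompact g] [IsReduced Y]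
    (hdim : topologicalKrullDim Y ≤ 1) :
    ∃ (Y₂ : Scheme.{0}) (π : Y₂ ⟶ Y), IsProper π ∧ IsBirational π ∧
      ∀ x : Y₂, ∃ (S : Type) (_ : CommRing S) (_ : IsLocalRing S) (_ : IsNoetherianRing S)
        (_ : IsDomain S) (_ : CharP S p) (_ : Algebra (Y₂.presheaf.stalk x) S),
        Module.FaithfullyFlat (Y₂.presheaf.stalk x) S ∧
        ringKrullDim S = ringKrullDim (Y₂.presheaf.stalk x) ∧
        maximalIdeal S ≤ ((maximalIdeal (Y₂.presheaf.stalk x)).map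
          (algebraMap (Y₂.presheaf.stalk x) S)).radical ∧
        (IsFRational S p ∨
          ((∃ rs : List S, RingTheory.Sequence.IsRegular S rs ∧ (∀ r ∈ rs, r ∈ maximalIdeal S) ∧
              (rs.length : WithBot ℕ∞) = ringKrullDim S) ∧
            ∃ (d : ℕ) (g : S), ringKrullDim S = ((d + 1 : ℕ) : WithBot ℕ∞) ∧
              g ∈ maximalIdeal S ∧ g ≠ 0 ∧
              (∀ s : Fin d → S, (Ideal.span (insert g (Set.range s))).radical = maximalIdeal S →
                ∀ (y : S) (e : ℕ), y ^ p ^ e ∈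
                  Ideal.span {g} ⊔ frobeniusPower (p ^ e) (Ideal.span (Set.range s)) →
                  y ∈ Ideal.span (insert g (Set.range s))) ∧
              (∃ n : ℕ, ∀ ⦃m : ℕ⦄ (s : Fin m → S), IsSystemOfParameters s →
                ∀ y ∈ tightClosure p (Ideal.span (Set.range s)),
                  g ^ n * y ∈ Ideal.span (Set.range s)))) :=
  integralModel_of_hasResolution p k Y g (hasResolution_of_dim_le_one Y g hdim)

/-- **Reduced curves (and points) have F-rational proper birational models, unconditionally**: for a
reduced `Y` of finite type over a field `k` of prime characteristic `p` with `dim Y ≤ 1`, the crux's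
conclusion holds at `Y` — the normalisation is a finite resolution (`hasResolution_of_dim_le_one`) and a
resolution is a rung-3 model (`Negative.rungThreeModel_of_hasResolution`). With
`Negative.fRationalModification_without_antecedent_of_summit` restricted to `CossartPiltant2019` this
brackets the open content of the crux: dimension `2` unconditionally, dimension `4` modulo the named
fact. [cite: Hartshorne1977, Ch. V Rem. 3.8.1; folklore] -/
theorem rungThreeModel_of_dim_le_one {p : ℕ} (hp : p.Prime) (k : Type) [Field k] [CharP k p]
    (Y : Scheme.{0}) (g : Y ⟶ Spec (.of k)) [LocallyOfFiniteType g] [QuasiCompact g] [IsReduced Y]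
    (hdim : topologicalKrullDim Y ≤ 1) :
    ∃ (Y₂ : Scheme.{0}) (π : Y₂ ⟶ Y), IsProper π ∧ IsBirational π ∧ ∀ x : Y₂,
      (IsDomain (Y₂.presheaf.stalk x) ∧ ∀ d : ℕ, ringKrullDim (Y₂.presheaf.stalk x) = d →
        ∀ s : Fin d → (Y₂.presheaf.stalk x), (Ideal.span (Set.range s)).radical.IsMaximal →
          ∀ y c : (Y₂.presheaf.stalk x), c ≠ 0 →
            (∀ e : ℕ, c * y ^ p ^ e ∈ Ideal.span ((fun z : (Y₂.presheaf.stalk x) => z ^ p ^ e) ''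
              (Ideal.span (Set.range s) : Set (Y₂.presheaf.stalk x)))) →
            y ∈ Ideal.span (Set.range s)) :=
  Negative.rungThreeModel_of_hasResolution hp g (hasResolution_of_dim_le_one Y g hdim)

end Summit.ResolutionOfSingularities.ResolutionOfSingularities.Theorems.FRationalModification.IntegralForm

end
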